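import Literature.AlgebraicGeometry.HodgeTheory.WeilClassesDescendingOfLefschetzOneOne
import Literature.AlgebraicGeometry.HodgeTheory.ChernCharacterBetti

/-!
# Venture HSemireg — the comparison `∧ ↦ ⌣` is multiplicative on pure degrees; powers of a 2-vector read cup powers

HONEST FRAMING. Part of the Lean index of the computation cell `pub-hsemireg` (seat w3-mod4-1 gen 8, W3 SPECIAL FIBRES,
MOD4-OFFSPLIT §13). The Literature layer `AlgebraicTopology/SingularHomology` (the comparison `wedgeToCup : ⋀ᵈ H¹ → Hᵈ`,
`cupPowOne`, `cupProduct`) and `HodgeTheory/ChernCharacterBetti` (`cupPowTwo`) ONLY; any space, any commutative ring with `2`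
invertible for the product rule. No variety-specific input; nothing here says that HC / HC_CM / HC_AV holds; no Literature fact is
declared; NO definition is introduced.

WHAT IS PROVED. **`wedgeToCup_mul`**: for `x ∈ ⋀ᵃ H¹(Y; R)`, `y ∈ ⋀ᵇ H¹(Y; R)`,
`wedgeToCup (a + b) (x · y) = wedgeToCup a x ⌣ wedgeToCup b y` — the bilinear extension of the tree's pure-wedge identity
`cupProduct_cupPowOne_cupPowOne` (span induction on both factors over `ιMulti`); `pow_mem_exteriorPower_two_mul`
(`x ∈ ⋀² ⇒ x^m ∈ ⋀^{2m}`); **`wedgeToCup_pow_two`**: for `x ∈ ⋀² H¹(Y; ℂ)`, `wedgeToCup (2m) (x^m) = cupPowTwo (wedgeToCup 2 x) m`.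
Used by `WeilFrameCupVolume.lean` to state the volume hypothesis of THEOREM R in cohomology (`h^{2n} ≠ 0`). Everything PROVED,
0 sorry.
References: [LangeBirkenhake1992] Lemma 1.1.17, Exercise 1.1.6 (7); [Hatcher2002] §3.2 (graded commutativity / products).
-/

noncomputable section

open CliffordAlgebra (contractLeft)
open ExteriorAlgebra (ι)
open Module CategoryTheory
open Literature.AlgebraicGeometry.Motives Literature.AlgebraicGeometry.HodgeTheory
open Literature.AlgebraicTopology.SingularHomology

namespace Summit.Ventures.HSemireg.WeilFrame

/-! ### 1. `wedgeToCup` is multiplicative on pure degrees -/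

section Topology

variable (R : Type) [CommRing R] [Invertible (2 : R)] (Y : Type) [TopologicalSpace Y]

/-- **`∧ ↦ ⌣` is multiplicative:** `wedgeToCup (a + b) (x · y) = wedgeToCup a x ⌣ wedgeToCup b y` for `x ∈ ⋀ᵃ H¹`, `y ∈ ⋀ᵇ H¹`
(on pure wedges this is the tree's `cupProduct_cupPowOne_cupPowOne`; extend bilinearly).
[cite: LangeBirkenhake1992, Lemma 1.1.17] [cite: Hatcher2002, §3.2] -/
theorem wedgeToCup_mul {a b : ℕ} {x y : ExteriorAlgebra R (singularCohomology R R Y 1)}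
    (hx : x ∈ ⋀[R]^a (singularCohomology R R Y 1)) (hy : y ∈ ⋀[R]^b (singularCohomology R R Y 1)) :
    wedgeToCup R Y (a + b) ⟨x * y, SetLike.mul_mem_graded hx hy⟩ =
      cupProduct rfl (wedgeToCup R Y a ⟨x, hx⟩) (wedgeToCup R Y b ⟨y, hy⟩) := by
  -- span induction on `x`, then on `y`
  have hx' := hx
  rw [← ExteriorAlgebra.ιMulti_span_fixedDegree] at hx'
  induction hx' using Submodule.span_induction with
  | mem z hz =>
    obtain ⟨u, rfl⟩ := hz
    have hy' := hy
    rw [← ExteriorAlgebra.ιMulti_span_fixedDegree] at hy'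
    induction hy' using Submodule.span_induction with
    | mem z' hz' =>
      obtain ⟨w, rfl⟩ := hz'
      have hfn : (fun i => ι R (Fin.append u w i)) = Fin.append (fun i => ι R (u i)) (fun i => ι R (w i)) := by
        funext i
        refine Fin.addCases (fun j => ?_) (fun j => ?_) i
        · simp only [Fin.append_left]
        · simp only [Fin.append_right]
      have hprod : (⟨ExteriorAlgebra.ιMulti R a u * ExteriorAlgebra.ιMulti R b w, SetLike.mul_mem_graded hx hy⟩ :
          ⋀[R]^(a + b) (singularCohomology R R Y 1)) = exteriorPower.ιMulti R (a + b) (Fin.append u w) := by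
        apply Subtype.ext
        change ExteriorAlgebra.ιMulti R a u * ExteriorAlgebra.ιMulti R b w =
          ((exteriorPower.ιMulti R (a + b) (Fin.append u w) : ⋀[R]^(a + b) (singularCohomology R R Y 1)) :
            ExteriorAlgebra R (singularCohomology R R Y 1))
        rw [exteriorPower.ιMulti_apply_coe, ExteriorAlgebra.ιMulti_apply, ExteriorAlgebra.ιMulti_apply,
          ExteriorAlgebra.ιMulti_apply, ← List.prod_append, ← List.ofFn_fin_append, ← hfn]
      have hu : (⟨ExteriorAlgebra.ιMulti R a u, hx⟩ : ⋀[R]^a (singularCohomology R R Y 1)) = exteriorPower.ιMulti R a u :=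
        Subtype.ext (by rw [exteriorPower.ιMulti_apply_coe])
      have hw : (⟨ExteriorAlgebra.ιMulti R b w, hy⟩ : ⋀[R]^b (singularCohomology R R Y 1)) = exteriorPower.ιMulti R b w :=
        Subtype.ext (by rw [exteriorPower.ιMulti_apply_coe])
      rw [hprod, hu, hw, wedgeToCup_ιMulti, wedgeToCup_ιMulti, wedgeToCup_ιMulti, cupProduct_cupPowOne_cupPowOne]
    | zero =>
      have h0 : (⟨ExteriorAlgebra.ιMulti R a u * 0, SetLike.mul_mem_graded hx hy⟩ : ⋀[R]^(a + b) (singularCohomology R R Y 1)) = 0 :=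
        Subtype.ext (by change ExteriorAlgebra.ιMulti R a u * 0 = 0; rw [mul_zero])
      have h0' : (⟨(0 : ExteriorAlgebra R _), hy⟩ : ⋀[R]^b (singularCohomology R R Y 1)) = 0 := rfl
      rw [h0, h0', map_zero, map_zero, map_zero]
    | add y₁ y₂ hy₁ hy₂ ih₁ ih₂ =>
      have hy₁' : y₁ ∈ ⋀[R]^b (singularCohomology R R Y 1) := by rw [← ExteriorAlgebra.ιMulti_span_fixedDegree]; exact hy₁
      have hy₂' : y₂ ∈ ⋀[R]^b (singularCohomology R R Y 1) := by rw [← ExteriorAlgebra.ιMulti_span_fixedDegree]; exact hy₂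
      have hsplit : (⟨ExteriorAlgebra.ιMulti R a u * (y₁ + y₂), SetLike.mul_mem_graded hx hy⟩ :
          ⋀[R]^(a + b) (singularCohomology R R Y 1)) =
          ⟨_, SetLike.mul_mem_graded hx hy₁'⟩ + ⟨_, SetLike.mul_mem_graded hx hy₂'⟩ :=
        Subtype.ext (by
          change ExteriorAlgebra.ιMulti R a u * (y₁ + y₂) = ExteriorAlgebra.ιMulti R a u * y₁ + ExteriorAlgebra.ιMulti R a u * y₂
          rw [mul_add])
      have hsplit' : (⟨y₁ + y₂, hy⟩ : ⋀[R]^b (singularCohomology R R Y 1)) = ⟨y₁, hy₁'⟩ + ⟨y₂, hy₂'⟩ := rfl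
      rw [hsplit, hsplit', map_add, map_add, map_add, ih₁ hy₁', ih₂ hy₂']
    | smul t y₁ hy₁ ih =>
      have hy₁' : y₁ ∈ ⋀[R]^b (singularCohomology R R Y 1) := by rw [← ExteriorAlgebra.ιMulti_span_fixedDegree]; exact hy₁
      have hsplit : (⟨ExteriorAlgebra.ιMulti R a u * (t • y₁), SetLike.mul_mem_graded hx hy⟩ :
          ⋀[R]^(a + b) (singularCohomology R R Y 1)) = t • ⟨_, SetLike.mul_mem_graded hx hy₁'⟩ :=
        Subtype.ext (by
          change ExteriorAlgebra.ιMulti R a u * (t • y₁) = t • (ExteriorAlgebra.ιMulti R a u * y₁)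
          rw [mul_smul_comm])
      have hsplit' : (⟨t • y₁, hy⟩ : ⋀[R]^b (singularCohomology R R Y 1)) = t • ⟨y₁, hy₁'⟩ := rfl
      rw [hsplit, hsplit', map_smul, map_smul, map_smul, ih hy₁']
  | zero =>
    have h0 : (⟨0 * y, SetLike.mul_mem_graded hx hy⟩ : ⋀[R]^(a + b) (singularCohomology R R Y 1)) = 0 :=
      Subtype.ext (by change 0 * y = 0; rw [zero_mul])
    have h0' : (⟨(0 : ExteriorAlgebra R _), hx⟩ : ⋀[R]^a (singularCohomology R R Y 1)) = 0 := rfl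
    rw [h0, h0', map_zero, map_zero, map_zero, LinearMap.zero_apply]
  | add x₁ x₂ hx₁ hx₂ ih₁ ih₂ =>
    have hx₁' : x₁ ∈ ⋀[R]^a (singularCohomology R R Y 1) := by rw [← ExteriorAlgebra.ιMulti_span_fixedDegree]; exact hx₁
    have hx₂' : x₂ ∈ ⋀[R]^a (singularCohomology R R Y 1) := by rw [← ExteriorAlgebra.ιMulti_span_fixedDegree]; exact hx₂
    have hsplit : (⟨(x₁ + x₂) * y, SetLike.mul_mem_graded hx hy⟩ : ⋀[R]^(a + b) (singularCohomology R R Y 1)) =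
        ⟨_, SetLike.mul_mem_graded hx₁' hy⟩ + ⟨_, SetLike.mul_mem_graded hx₂' hy⟩ :=
      Subtype.ext (by change (x₁ + x₂) * y = x₁ * y + x₂ * y; rw [add_mul])
    have hsplit' : (⟨x₁ + x₂, hx⟩ : ⋀[R]^a (singularCohomology R R Y 1)) = ⟨x₁, hx₁'⟩ + ⟨x₂, hx₂'⟩ := rfl
    rw [hsplit, hsplit', map_add, map_add, map_add, LinearMap.add_apply, ih₁ hx₁', ih₂ hx₂']
  | smul t x₁ hx₁ ih =>
    have hx₁' : x₁ ∈ ⋀[R]^a (singularCohomology R R Y 1) := by rw [← ExteriorAlgebra.ιMulti_span_fixedDegree]; exact hx₁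
    have hsplit : (⟨(t • x₁) * y, SetLike.mul_mem_graded hx hy⟩ : ⋀[R]^(a + b) (singularCohomology R R Y 1)) =
        t • ⟨_, SetLike.mul_mem_graded hx₁' hy⟩ := Subtype.ext (by change (t • x₁) * y = t • (x₁ * y); rw [smul_mul_assoc])
    have hsplit' : (⟨t • x₁, hx⟩ : ⋀[R]^a (singularCohomology R R Y 1)) = t • ⟨x₁, hx₁'⟩ := rfl
    rw [hsplit, hsplit', map_smul, map_smul, map_smul, LinearMap.smul_apply, ih hx₁']

omit [Invertible (2 : R)] in
/-- powers of a degree-`2` element stay in pure degree: `x ∈ ⋀² ⇒ x^m ∈ ⋀^{2m}`. -/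
theorem pow_mem_exteriorPower_two_mul {M : Type*} [AddCommGroup M] [Module R M] {x : ExteriorAlgebra R M}
    (hx : x ∈ ⋀[R]^2 M) : ∀ m : ℕ, x ^ m ∈ ⋀[R]^(2 * m) M
  | 0 => by rw [mul_zero, pow_zero]; exact SetLike.one_mem_graded _
  | m + 1 => by rw [pow_succ]; exact SetLike.mul_mem_graded (pow_mem_exteriorPower_two_mul hx m) hx

end Topology

section TopologyComplex

variable (Y : Type) [TopologicalSpace Y]

/-- **`ĥ^m` reads `h^m`:** for `x ∈ ⋀² H¹`, `wedgeToCup (2m) (x^m) = cupPowTwo (wedgeToCup 2 x) m`.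
[cite: LangeBirkenhake1992, Lemma 1.1.17] [cite: Hatcher2002, §3.2] -/
theorem wedgeToCup_pow_two :
    ∀ {x : ExteriorAlgebra ℂ (singularCohomology ℂ ℂ Y 1)} (hx : x ∈ ⋀[ℂ]^2 (singularCohomology ℂ ℂ Y 1)) (m : ℕ),
      wedgeToCup ℂ Y (2 * m) ⟨x ^ m, pow_mem_exteriorPower_two_mul ℂ hx m⟩ = cupPowTwo (wedgeToCup ℂ Y 2 ⟨x, hx⟩) m
  | x, hx, 0 => by
    have h1 : (⟨x ^ 0, pow_mem_exteriorPower_two_mul ℂ hx 0⟩ : ⋀[ℂ]^(2 * 0) (singularCohomology ℂ ℂ Y 1)) =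
        exteriorPower.ιMulti ℂ 0 Fin.elim0 := Subtype.ext (by
      change x ^ 0 = ((exteriorPower.ιMulti ℂ 0 Fin.elim0 : ⋀[ℂ]^0 (singularCohomology ℂ ℂ Y 1)) : ExteriorAlgebra ℂ _)
      rw [pow_zero, exteriorPower.ιMulti_apply_coe, ExteriorAlgebra.ιMulti_zero_apply])
    rw [cupPowTwo, h1, wedgeToCup_ιMulti, cupPowOne_zero]
  | x, hx, m + 1 => by
    have hsplit : (⟨x ^ (m + 1), pow_mem_exteriorPower_two_mul ℂ hx (m + 1)⟩ : ⋀[ℂ]^(2 * (m + 1)) (singularCohomology ℂ ℂ Y 1)) =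
        ⟨x ^ m * x, SetLike.mul_mem_graded (pow_mem_exteriorPower_two_mul ℂ hx m) hx⟩ :=
      Subtype.ext (by change x ^ (m + 1) = x ^ m * x; rw [pow_succ])
    rw [cupPowTwo, hsplit]
    change wedgeToCup ℂ Y (2 * m + 2) ⟨x ^ m * x, SetLike.mul_mem_graded (pow_mem_exteriorPower_two_mul ℂ hx m) hx⟩ =
      cupProduct rfl (cupPowTwo (wedgeToCup ℂ Y 2 ⟨x, hx⟩) m) (wedgeToCup ℂ Y 2 ⟨x, hx⟩)
    rw [wedgeToCup_mul ℂ Y (pow_mem_exteriorPower_two_mul ℂ hx m) hx, wedgeToCup_pow_two hx m]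

end TopologyComplex

end Summit.Ventures.HSemireg.WeilFrame

end
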